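import Mathlib.Topology.Algebra.Group.Quotient
import Mathlib.Topology.Algebra.ContinuousMonoidHom
import Mathlib.Topology.Algebra.OpenSubgroup
import Mathlib.Tactic.Group
import HarnessLib

/-!
# Lifting a compatible system of quotient isomorphisms to the inverse limit ([SemiAnbd] Thm 6.6, proof, p. 73)

Mochizuki, *Semi-graphs of anabelioids*, Publ. RIMS **42** (2006) [SemiAnbd], §6, proof of
Theorem 6.6 (author's manuscript p. 73, lines 18–21): "Thus, by passing to the corresponding
inverse limit, we conclude that the various `β_H` determine an isomorphism of tempered fundamental
groups `β : Π^temp_{X_K} ⥲ Π^temp_{Y_L}` whose profinite completion `β̂` differs from `α̂` by an inner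
automorphism". [cite: MochizukiSemiAnbd2006, Thm 6.6 proof p.73]

This file proves the ABSTRACT topological-group statement behind that sentence (sub-node L08 of
the abc-iut sub-DAG `plan/L3/SUBDAG-SemiAnbd-Thm66.md`), with no [SemiAnbd] data in it:

* `TX`, `TY` are topological groups with systems of normal subgroups `JX n`, `JY n` (`n : ℕ`, a
  cofinal sequence of the printed index set `{H_X}`), for which `TX`, `TY` are *separated*
  (`⋂ J = 1`), carry the *initial topology* of the quotient maps (`IsInitialFor`), and are
  *complete* (`IsCompleteFor`: every coherent sequence of cosets is the sequence of cosets of an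
  element) — i.e. `T = lim T/J_n` as topological groups;
* `β n : TX ⧸ JX n ≃ₜ* TY ⧸ JY n` are isomorphisms compatible along `n + 1 → n` UP TO INNER
  AUTOMORPHISM (print: "the resulting `β_H`'s are compatible [up to inner automorphism]");
* `a : TX → PY` is any map into a compact topological group `PY` (in print: `α̂ ∘ ι_X` into the
  profinite completion `Π_{Y_L}`), `ιY : TY →* PY` (print: `Π^temp_{Y_L} ↪ Π_{Y_L}`), and `KY n` are
  closed subsets of `PY` shrinking to `1` such that, for each `n`, `a` agrees with
  `Inn(e_n) ∘ ιY ∘ (lift of β n)` modulo `KY n` (print: "the profinite completion `β̂_H` differs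
  from the isomorphism … induced by `α̂` by composition with an inner automorphism").

Conclusion (`exists_continuousMulEquiv_liesUnder`): there are `β : TX ≃ₜ* TY` and `f ∈ PY` with
`a g = f · ιY (β g) · f⁻¹` for all `g`.  OUR proof (print does not spell it out): (a) rectify the
`β n` inductively by inner automorphisms so that they are compatible on the nose, (b) completeness
and separation give a bijective homomorphism, continuous in both directions by the
initial-topology hypothesis, (c) the sets of admissible conjugators modulo `KY n` are non-empty,
closed and decreasing in the compact group `PY`, hence have a common point.  Classical; nothing
here concerns the disputed parts of inter-universal Teichmüller theory, and nothing takes a side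
on [IUTchIII] Cor. 3.12.
-/

namespace Literature.AnabelianGeometry.SemiGraphs

namespace QuotientIsoSystemLift

open _root_.Topology _root_.Filter

universe u v w

variable {TX : Type u} {TY : Type v} {PY : Type w}

/-- Separation by a family of subgroups: two elements congruent modulo every `J n` are equal.
[folklore] -/
private theorem eq_of_forall_inv_mul_mem [Group TY] {J : ℕ → Subgroup TY}
    (sep : ∀ t : TY, (∀ n, t ∈ J n) → t = 1) {t t' : TY} (h : ∀ n, t⁻¹ * t' ∈ J n) : t = t' :=
  inv_mul_eq_one.mp (sep _ h)

section Levels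

variable [Group TX] [TopologicalSpace TX] [Group TY] [TopologicalSpace TY]
variable (JX : ℕ → Subgroup TX) (JY : ℕ → Subgroup TY)
variable [hnX : ∀ n, (JX n).Normal] [hnY : ∀ n, (JY n).Normal]

/-- The rectified level-`n` map `q ↦ [d n] · β n q · [d n]⁻¹` is continuous. [folklore] -/
private theorem continuous_conjLevel [IsTopologicalGroup TY] (β : ∀ n, TX ⧸ JX n ≃ₜ* TY ⧸ JY n)
    (d : ℕ → TY) (n : ℕ) :
    Continuous fun q : TX ⧸ JX n =>
      ((d n : TY) : TY ⧸ JY n) * β n q * ((d n : TY) : TY ⧸ JY n)⁻¹ :=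
  (continuous_const.mul (β n).continuous).mul continuous_const

/-- The rectified level-`n` map is injective. [folklore] -/
private theorem conjLevel_injective (β : ∀ n, TX ⧸ JX n ≃ₜ* TY ⧸ JY n) (d : ℕ → TY) (n : ℕ) :
    Function.Injective fun q : TX ⧸ JX n =>
      ((d n : TY) : TY ⧸ JY n) * β n q * ((d n : TY) : TY ⧸ JY n)⁻¹ := by
  intro q q' h
  exact (β n).injective (mul_left_cancel (mul_right_cancel h))

/-- The explicit inverse of the rectified level map. [folklore] -/
private theorem conjLevel_symm_apply (β : ∀ n, TX ⧸ JX n ≃ₜ* TY ⧸ JY n) (d : ℕ → TY) (n : ℕ)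
    (r : TY ⧸ JY n) :
    ((d n : TY) : TY ⧸ JY n) *
        β n ((β n).symm (((d n : TY) : TY ⧸ JY n)⁻¹ * r * ((d n : TY) : TY ⧸ JY n))) *
          ((d n : TY) : TY ⧸ JY n)⁻¹ = r := by
  rw [ContinuousMulEquiv.apply_symm_apply]
  group

/-- The explicit inverse of the rectified level map is continuous. [folklore] -/
private theorem continuous_conjLevel_symm [IsTopologicalGroup TY] (β : ∀ n, TX ⧸ JX n ≃ₜ* TY ⧸ JY n)
    (d : ℕ → TY) (n : ℕ) :
    Continuous fun r : TY ⧸ JY n =>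
      (β n).symm (((d n : TY) : TY ⧸ JY n)⁻¹ * r * ((d n : TY) : TY ⧸ JY n)) :=
  (β n).symm.continuous.comp ((continuous_const.mul continuous_id).mul continuous_const)

/-- RECTIFICATION: if the `β n` are compatible along `n + 1 → n` up to the inner automorphisms
`Inn(c n)` of `TY ⧸ JY n`, then the maps `q ↦ [d n] · β n q · [d n]⁻¹` with `d (n+1) = d n · (c n)⁻¹`
are compatible on the nose. [folklore] -/
private theorem conjLevel_compat (β : ∀ n, TX ⧸ JX n ≃ₜ* TY ⧸ JY n) (c d : ℕ → TY)
    (hc : ∀ n (g : TX) (y y' : TY), β (n + 1) (g : TX ⧸ JX (n + 1)) = (y' : TY ⧸ JY (n + 1)) →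
      β n (g : TX ⧸ JX n) = (y : TY ⧸ JY n) → (c n * y * (c n)⁻¹)⁻¹ * y' ∈ JY n)
    (hd : ∀ n, d (n + 1) = d n * (c n)⁻¹) (n : ℕ) (g : TX) (y' : TY)
    (h : ((d (n + 1) : TY) : TY ⧸ JY (n + 1)) * β (n + 1) (g : TX ⧸ JX (n + 1)) *
      ((d (n + 1) : TY) : TY ⧸ JY (n + 1))⁻¹ = (y' : TY ⧸ JY (n + 1))) :
    ((d n : TY) : TY ⧸ JY n) * β n (g : TX ⧸ JX n) * ((d n : TY) : TY ⧸ JY n)⁻¹ =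
      (y' : TY ⧸ JY n) := by
  obtain ⟨y, hy⟩ := QuotientGroup.mk_surjective (β n (g : TX ⧸ JX n))
  -- unpack the level-(n+1) hypothesis: β (n+1) [g] = [d(n+1)⁻¹ y' d(n+1)]
  have h1 : β (n + 1) (g : TX ⧸ JX (n + 1)) =
      ((d (n + 1))⁻¹ * y' * d (n + 1) : TY) := by
    rw [QuotientGroup.mk_mul, QuotientGroup.mk_mul, QuotientGroup.mk_inv, ← h]
    group
  have h2 := hc n g y ((d (n + 1))⁻¹ * y' * d (n + 1)) h1 hy.symm
  -- so [d(n+1)⁻¹ y' d(n+1)] = [c y c⁻¹] in TY ⧸ JY n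
  have h3 : (((d (n + 1))⁻¹ * y' * d (n + 1) : TY) : TY ⧸ JY n) =
      ((c n * y * (c n)⁻¹ : TY) : TY ⧸ JY n) := by
    rw [eq_comm, QuotientGroup.eq]; exact h2
  rw [← hy]
  simp only [QuotientGroup.mk_mul, QuotientGroup.mk_inv, hd] at h3 ⊢
  -- h3 : [d n c⁻¹]⁻¹ [y'] [d n c⁻¹] = [c][y][c]⁻¹ ; goal : [d n][y][d n]⁻¹ = [y']
  have h4 : (y' : TY ⧸ JY n) =
      ((d n : TY) : TY ⧸ JY n) * ((c n : TY) : TY ⧸ JY n)⁻¹ *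
        (((c n : TY) : TY ⧸ JY n) * (y : TY ⧸ JY n) * ((c n : TY) : TY ⧸ JY n)⁻¹) *
          (((d n : TY) : TY ⧸ JY n) * ((c n : TY) : TY ⧸ JY n)⁻¹)⁻¹ := by
    rw [← h3]; group
  rw [h4]; group

end Levels

section Main

variable [Group TX] [TopologicalSpace TX] [IsTopologicalGroup TX]
variable [Group TY] [TopologicalSpace TY] [IsTopologicalGroup TY]
variable [Group PY] [TopologicalSpace PY] [IsTopologicalGroup PY] [CompactSpace PY]

/-- **The inverse-limit step of the proof of [SemiAnbd] Theorem 6.6** (Mochizuki 2006, p. 73,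
"by passing to the corresponding inverse limit … the various `β_H` determine an isomorphism of
tempered fundamental groups `β` … whose profinite completion `β̂` differs from `α̂` by an inner
automorphism"), in abstract form: a system of isomorphisms `β n : TX ⧸ JX n ≃ₜ* TY ⧸ JY n`
compatible up to inner automorphisms, over separated, initial and complete systems of normal
subgroups, lifts to `β : TX ≃ₜ* TY`; and if a map `a : TX → PY` into a compact group agrees with
`Inn(e_n) ∘ ιY ∘ β n` modulo closed sets `KY n ⊆ PY` shrinking to `1`, then `a = Inn(f) ∘ ιY ∘ β`
for one `f ∈ PY`.  OUR proof of a step the print leaves to the reader; classical.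
[cite: MochizukiSemiAnbd2006, Thm 6.6 proof p.73] -/
theorem exists_continuousMulEquiv_liesUnder
    (JX : ℕ → Subgroup TX) (JY : ℕ → Subgroup TY) [hnX : ∀ n, (JX n).Normal]
    [hnY : ∀ n, (JY n).Normal]
    (sepX : ∀ t : TX, (∀ n, t ∈ JX n) → t = 1) (sepY : ∀ t : TY, (∀ n, t ∈ JY n) → t = 1)
    (initX : ∀ U : Set TX, IsOpen U → (1 : TX) ∈ U → ∃ n, ∃ W : Set (TX ⧸ JX n),
      IsOpen W ∧ ((1 : TX) : TX ⧸ JX n) ∈ W ∧ QuotientGroup.mk ⁻¹' W ⊆ U)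
    (initY : ∀ U : Set TY, IsOpen U → (1 : TY) ∈ U → ∃ n, ∃ W : Set (TY ⧸ JY n),
      IsOpen W ∧ ((1 : TY) : TY ⧸ JY n) ∈ W ∧ QuotientGroup.mk ⁻¹' W ⊆ U)
    (complX : ∀ s : ℕ → TX, (∀ n, (s n)⁻¹ * s (n + 1) ∈ JX n) → ∃ t : TX, ∀ n, t⁻¹ * s n ∈ JX n)
    (complY : ∀ s : ℕ → TY, (∀ n, (s n)⁻¹ * s (n + 1) ∈ JY n) → ∃ t : TY, ∀ n, t⁻¹ * s n ∈ JY n)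
    (β : ∀ n, TX ⧸ JX n ≃ₜ* TY ⧸ JY n)
    (compat : ∀ n, ∃ c : TY, ∀ (g : TX) (y y' : TY),
      β (n + 1) (g : TX ⧸ JX (n + 1)) = (y' : TY ⧸ JY (n + 1)) →
        β n (g : TX ⧸ JX n) = (y : TY ⧸ JY n) → (c * y * c⁻¹)⁻¹ * y' ∈ JY n)
    (ιY : TY →* PY) (a : TX → PY) (KY : ℕ → Set PY) (hKc : ∀ n, IsClosed (KY n))
    (hKa : ∀ n, KY (n + 1) ⊆ KY n) (sepK : ∀ z : PY, (∀ n, z ∈ KY n) → z = 1)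
    (underHat : ∀ n, ∃ e : PY, ∀ (g : TX) (y : TY), β n (g : TX ⧸ JX n) = (y : TY ⧸ JY n) →
      (e * ιY y * e⁻¹)⁻¹ * a g ∈ KY n) :
    ∃ βlim : TX ≃ₜ* TY, ∃ f : PY, ∀ g : TX, a g = f * ιY (βlim g) * f⁻¹ := by
  classical
  -- (a) rectification
  choose c hc using compat
  let d : ℕ → TY := fun n => Nat.rec (motive := fun _ => TY) 1 (fun k dk => dk * (c k)⁻¹) n
  have hd : ∀ n, d (n + 1) = d n * (c n)⁻¹ := fun n => rfl
  let B : ∀ n, TX ⧸ JX n →* TY ⧸ JY n := fun n =>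
    (MulAut.conj ((d n : TY) : TY ⧸ JY n)).toMonoidHom.comp (β n).toMonoidHom
  have hB : ∀ n (q : TX ⧸ JX n),
      B n q = ((d n : TY) : TY ⧸ JY n) * β n q * ((d n : TY) : TY ⧸ JY n)⁻¹ := fun n q => rfl
  have hBcompat : ∀ n (g : TX) (y' : TY), B (n + 1) (g : TX ⧸ JX (n + 1)) = (y' : TY ⧸ JY (n + 1)) →
      B n (g : TX ⧸ JX n) = (y' : TY ⧸ JY n) := fun n g y' h => by
    rw [hB] at h ⊢
    exact conjLevel_compat JX JY β c d hc hd n g y' h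
  -- (b) lifts and the limit map `TX → TY`
  choose bl hbl using fun n (g : TX) => QuotientGroup.mk_surjective (B n (g : TX ⧸ JX n))
  have hbl_coh : ∀ g n, (bl n g)⁻¹ * bl (n + 1) g ∈ JY n := fun g n => by
    rw [← QuotientGroup.eq, hbl, hBcompat n g (bl (n + 1) g) (hbl (n + 1) g).symm]
  choose βf hβf using fun g => complY (fun n => bl n g) (hbl_coh g)
  have hβf_level : ∀ n (g : TX), B n (g : TX ⧸ JX n) = ((βf g : TY) : TY ⧸ JY n) :=
      fun n g => by
    rw [← hbl, eq_comm, QuotientGroup.eq]; exact hβf g n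
  have hmul : ∀ g h : TX, βf (g * h) = βf g * βf h := fun g h => by
    refine eq_of_forall_inv_mul_mem sepY fun n => ?_
    rw [← QuotientGroup.eq, ← hβf_level, QuotientGroup.mk_mul, QuotientGroup.mk_mul, map_mul,
      hβf_level, hβf_level]
  -- the inverse map `TY → TX`
  have hsurj : ∀ n (y : TY), ∃ x : TX, B n (x : TX ⧸ JX n) = (y : TY ⧸ JY n) := fun n y => by
    obtain ⟨x, hx⟩ := QuotientGroup.mk_surjective
      ((β n).symm (((d n : TY) : TY ⧸ JY n)⁻¹ * (y : TY ⧸ JY n) * ((d n : TY) : TY ⧸ JY n)))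
    exact ⟨x, by rw [hx, hB, conjLevel_symm_apply]⟩
  choose bx hbx using hsurj
  have hBinj : ∀ n (x x' : TX), B n (x : TX ⧸ JX n) = B n (x' : TX ⧸ JX n) →
      (x : TX ⧸ JX n) = (x' : TX ⧸ JX n) := fun n x x' h =>
    conjLevel_injective JX JY β d n (by simpa only [hB] using h)
  have hbx_coh : ∀ y n, (bx n y)⁻¹ * bx (n + 1) y ∈ JX n := fun y n => by
    rw [← QuotientGroup.eq]
    refine hBinj n _ _ ?_
    rw [hbx, hBcompat n (bx (n + 1) y) y (hbx (n + 1) y)]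
  choose βg hβg using fun y => complX (fun n => bx n y) (hbx_coh y)
  have hβg_level : ∀ n y, B n (βg y : TX ⧸ JX n) = (y : TY ⧸ JY n) := fun n y => by
    have : (βg y : TX ⧸ JX n) = (bx n y : TX ⧸ JX n) := by
      rw [QuotientGroup.eq]; exact hβg y n
    rw [this, hbx]
  have hleft : Function.LeftInverse βg βf := fun g => by
    refine eq_of_forall_inv_mul_mem sepX fun n => ?_
    rw [← QuotientGroup.eq]
    exact hBinj n _ _ (by rw [hβg_level, hβf_level])
  have hright : Function.RightInverse βg βf := fun y => by
    refine eq_of_forall_inv_mul_mem sepY fun n => ?_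
    rw [← QuotientGroup.eq, ← hβf_level, hβg_level]
  let βe : TX ≃* TY := MulEquiv.mk ⟨βf, βg, hleft, hright⟩ hmul
  -- continuity of `βf` and `βg` from the initial-topology hypotheses
  have hcontB : ∀ n, Continuous (B n) := fun n => by
    rw [show ⇑(B n) = (fun q => ((d n : TY) : TY ⧸ JY n) * β n q * ((d n : TY) : TY ⧸ JY n)⁻¹)
      from funext (hB n)]
    exact continuous_conjLevel JX JY β d n
  have hβf_cont : Continuous βe := by
    refine continuous_of_continuousAt_one βe ?_
    rw [continuousAt_def, map_one]
    intro A hA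
    obtain ⟨U, hUA, hUo, h1U⟩ := mem_nhds_iff.mp hA
    obtain ⟨n, W, hWo, h1W, hWU⟩ := initY U hUo h1U
    have hVo : IsOpen (QuotientGroup.mk ⁻¹' (B n ⁻¹' W) : Set TX) :=
      (hWo.preimage (hcontB n)).preimage QuotientGroup.continuous_mk
    refine Filter.mem_of_superset (hVo.mem_nhds ?_) ?_
    · show B n ((1 : TX) : TX ⧸ JX n) ∈ W
      rw [QuotientGroup.mk_one, map_one]; exact h1W
    · intro v hv
      have hv' : B n (v : TX ⧸ JX n) ∈ W := hv
      rw [hβf_level] at hv'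
      exact hUA (hWU hv')
  have hβg_cont : Continuous βe.symm := by
    refine continuous_of_continuousAt_one βe.symm ?_
    rw [continuousAt_def, map_one]
    intro A hA
    obtain ⟨U, hUA, hUo, h1U⟩ := mem_nhds_iff.mp hA
    obtain ⟨n, W, hWo, h1W, hWU⟩ := initX U hUo h1U
    let G : TY ⧸ JY n → TX ⧸ JX n := fun r =>
      (β n).symm (((d n : TY) : TY ⧸ JY n)⁻¹ * r * ((d n : TY) : TY ⧸ JY n))
    have hGcont : Continuous G := continuous_conjLevel_symm JX JY β d n
    have hGB : ∀ q, G (B n q) = q := fun q =>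
      conjLevel_injective JX JY β d n (by
        simp only [G, ← hB]
        rw [hB n ((β n).symm _), conjLevel_symm_apply])
    have hVo : IsOpen (QuotientGroup.mk ⁻¹' (G ⁻¹' W) : Set TY) :=
      (hWo.preimage hGcont).preimage QuotientGroup.continuous_mk
    refine Filter.mem_of_superset (hVo.mem_nhds ?_) ?_
    · show G ((1 : TY) : TY ⧸ JY n) ∈ W
      have : G ((1 : TY) : TY ⧸ JY n) = 1 := by
        have h := hGB 1
        rw [map_one] at h
        rw [QuotientGroup.mk_one]; exact h
      rw [this]; exact h1W
    · intro y hy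
      have hy' : G (y : TY ⧸ JY n) ∈ W := hy
      have : (βe.symm y : TX ⧸ JX n) = G (y : TY ⧸ JY n) := by
        rw [← hGB (βe.symm y : TX ⧸ JX n)]
        exact congrArg G (hβg_level n y)
      apply hUA; apply hWU
      show ((βe.symm y : TX) : TX ⧸ JX n) ∈ W
      rw [this]; exact hy'
  let βt : TX ≃ₜ* TY := ContinuousMulEquiv.mk βe hβf_cont hβg_cont
  -- (c) the conjugator in the compact group `PY`
  choose e he using underHat
  have hlevel : ∀ n g, (e n * (ιY (d n))⁻¹ * ιY (βf g) * (e n * (ιY (d n))⁻¹)⁻¹)⁻¹ * a g ∈ KY n :=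
    fun n g => by
    have h1 : β n (g : TX ⧸ JX n) = (((d n)⁻¹ * βf g * d n : TY) : TY ⧸ JY n) := by
      have h2 := hβf_level n g
      rw [hB] at h2
      rw [QuotientGroup.mk_mul, QuotientGroup.mk_mul, QuotientGroup.mk_inv, ← h2]
      group
    have h3 := he n g _ h1
    have h4 : e n * ιY ((d n)⁻¹ * βf g * d n) * (e n)⁻¹ =
        e n * (ιY (d n))⁻¹ * ιY (βf g) * (e n * (ιY (d n))⁻¹)⁻¹ := by
      simp only [map_mul, map_inv]; group
    rw [← h4]; exact h3
  let C : ℕ → Set PY := fun n => {f | ∀ g : TX, (f * ιY (βf g) * f⁻¹)⁻¹ * a g ∈ KY n}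
  have hCclosed : ∀ n, IsClosed (C n) := fun n => by
    have : C n = ⋂ g : TX, (fun f : PY => (f * ιY (βf g) * f⁻¹)⁻¹ * a g) ⁻¹' KY n := by
      ext f; simp [C]
    rw [this]
    refine isClosed_iInter fun g => (hKc n).preimage ?_
    exact (((continuous_id.mul continuous_const).mul continuous_id.inv).inv).mul continuous_const
  have hCne : ∀ n, (C n).Nonempty := fun n => ⟨e n * (ιY (d n))⁻¹, fun g => hlevel n g⟩
  have hCanti : ∀ n, C (n + 1) ⊆ C n := fun n f hf g => hKa n (hf g)
  obtain ⟨f, hf⟩ := IsCompact.nonempty_iInter_of_sequence_nonempty_isCompact_isClosed C hCanti hCne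
    (hCclosed 0).isCompact hCclosed
  refine ⟨βt, f, fun g => ?_⟩
  have hfg : ∀ n, (f * ιY (βf g) * f⁻¹)⁻¹ * a g ∈ KY n := fun n => (Set.mem_iInter.mp hf n) g
  have := sepK _ hfg
  rw [inv_mul_eq_one] at this
  exact this.symm

end Main

end QuotientIsoSystemLift

end Literature.AnabelianGeometry.SemiGraphs
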